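import Summits.AtomisticToContinuum.Crystallization.Theorems.ChartedZeroExcessLayeredLatticeLiouvilleZZZYRCN

/-!
# Charted zero-excess layered-lattice Liouville — ZZZYRCD: «TailDebit», the far tail moved INSIDE the cluster form (edition 3c of D⁗)

Cell `decomp-a2c`, lens 2 «structural dichotomy (special | generic)», generation 99.  D⁗ (ZZZYRC, (243)) prices the far tail `‖e‖ > ϱ` of the
harmonic form by a SCALAR in contact-displacement currency, `−2τ·N₁` ((TL♯) `TailBoundP`), and the certificate (JF♯) must then close
`2(κ₁ + τ) ≤ μ·cK − ν`.  Desk TAIL99 / TAUOPT99 / BLOCH99 (memo NODE-g99 §1–§2) measured that currency at the thin tensile corner of the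
clean window: the TRUE far cost of the soft mode is `0.004·N₁` at `ϱ = 4` (Bloch, fcc proxy of the JS53 minimiser `(1, 1.04) ⊕ (−1,+1,+1)`,
`κ_full = 0.195`), but ANY scalar `N₁`-price is bounded below by the plane-wave floor `2τ_opt(4) ≈ 0.05–0.07` (it must charge the soft
interlayer-shear mode for the far cost of the stiff uniaxial modes) — above the certified thin margin `0.05`; the scalar line cannot close below
`ϱ ≈ 6`.  This file replaces the scalar price by a QUADRATIC DEBIT FORM ON IN-RANGE PAIRS, absorbed centre by centre inside D⁗'s cluster form:

* the termwise far bound `⟨Δφ, K_e Δφ⟩ ≥ −a₋(‖e‖)·⟨ê, Δφ⟩²` (`a₋ = (7r⁻⁸ − 13r⁻¹⁴)₊`, decreasing beyond `1.2171`; the transverse part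
  `(r⁻⁸ − r⁻¹⁴)·|P_⊥Δφ|² ≥ 0` is dropped) and, for each far ordered pair `(X, Y)`, an INDEX SPLIT `X = P₀, P₁, …, P_n = Y` through actual sites
  with every piece `e_i = P_i − P_{i−1}` of length `≤ ϱ` (`n = ⌈‖e‖/ϱ_p⌉`, `P_i` the site nearest to `X + i·e/n`; always available in a layered
  word), and the exact algebra `⟨ê, Δφ⟩ = Σ_i (cos θ_i·⟨ê_i, Δ_iφ⟩ + ⟨ê − cos θ_i·ê_i, Δ_iφ⟩)`, `‖ê − cos θ_i·ê_i‖² = sin² θ_i`, give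
  `a₋·⟨ê, Δφ⟩² ≤ Σ_i [(1+α)·n·cos² θ_i·a₋]·⟨ê_i, Δ_iφ⟩² + Σ_i [(1+1/α)·n·sin² θ_i·a₋]·‖Δ_iφ‖²` — a RADIAL DEBIT and a LEAK DEBIT on the
  in-range pieces.  Summed over all far pairs (absolutely convergent: `Σ n·a₋ ~ Σ r⁻⁷·r²`) and re-indexed by piece, the far tail is bounded
  below by `−debitForm ϱ θR θN`, a form on the pairs of length `≤ ϱ` with WORD-INDEXED coefficient tables `θR, θN ≥ 0` ((TL♯-D) `TailDebitP`);
* the debit of each in-range pair is shared among the clusters containing it with D⁗'s pair weights ((PF♯-D) `PartitionIdentityDebitP`, the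
  pair half of (PF♯) verbatim), and the certificate asks `clusterDebit ≤ clusterFormFull` at every centre with the TAIL-FREE closure
  `2κ₁ ≤ μ·cK − ν` ((JF♯-D) `ClusterCertificateDebitP`);
* the glue is D⁗'s arithmetic at `τ = 0` with `H ↦ H − debit` (`signedShellBudgetP_of_clusterCertificateDebit`,
  `uniformEquilStabilityAt_of_clusterCertificateDebit`, PROVED; (NL♯) is ZZZYRCN's theorem).

Desk BLOCH99 (fcc, thin corner, `α = 1/2`, `ϱ_p = ϱ − 0.9`): debit cost of the soft mode `0.016–0.022·N₁` at `ϱ = 4` (radial `0.012`, leak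
`0.005–0.009`; `3.5–4×` the true far cost, `5–6×` below the scalar price), `0.0075` at `ϱ = 5`, `0.0037` at `ϱ = 6`; worst-mode ratio
`sup_φ debit/N₁ = 0.053 (ϱ 4) / 0.026 (ϱ 5)` on uniaxial long waves, where the form has slack `≈ 1`.  Expected closure at `(ϱ, R) = (4, 3)`,
`cK = 1/10`, `κ₁ = 1/100`: `0.05 − 0.02 ≥ 2κ₁` (thin); at `(5, 7/2)`: `0.05 − 0.01 ≥ 2κ₁`; census TAIL-DEBIT PILOT decides (memo §2 (d)).
The tables `(θR, θN)` are DATA shared by the analytic side ((TL♯-D), which holds for every table dominating the scheme's exact sums: `a₋` at a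
length floor, `cos² ≤ 1`, `sin²` at a cone ceiling) and the instrumented side ((JF♯-D), read per box).  Def + theorem file (6 defs, 2 theorems);
imports ZZZYRCN only; no instance / notation / option; 0 sorry; no numeric record instance (r1768). [g99]
-/

open scoped BigOperators InnerProductSpace RealInnerProductSpace

namespace Summit.AtomisticToContinuum.Crystallization.Theorems.ChartedZeroExcessLayeredLatticeLiouville

open Summit.AtomisticToContinuum.Crystallization.Theorems.ChartedPlanarOrderRigidityDoor (E3)

/-! ### The debit form and its cluster shares -/

/-- THE DEBIT of the ordered pair `x` under `φ` for the pair tables `(θR, θN)`: `θR x·⟨ê, Δφ⟩² + θN x·‖Δφ‖²` (radial debit in squared-stretch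
currency `sqStretch`, leak debit in displacement currency). [g99] -/
noncomputable def pairDebit (θR θN : (Cell 2 × ℤ) × (Cell 2 × ℤ) → ℝ) (a b : E3) (w : ℤ → E3) (φ : Cell 2 → ℤ → E3) (x : (Cell 2 × ℤ) × (Cell 2 × ℤ)) : ℝ :=
  θR x * sqStretch a b w φ x + θN x * ‖φ x.2.1 x.2.2 - φ x.1.1 x.1.2‖ ^ 2

/-- THE DEBIT FORM `Σ_{0 < ‖e‖ ≤ ϱ} pairDebit` over ordered in-range pairs (a `finsum`, finite for finitely supported `φ` on a co-Lipschitz word,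
whatever the tables). [g99] -/
noncomputable def debitForm (ϱ : ℝ) (θR θN : (Cell 2 × ℤ) × (Cell 2 × ℤ) → ℝ) (a b : E3) (w : ℤ → E3) (φ : Cell 2 → ℤ → E3) : ℝ :=
  ∑ᶠ x : (Cell 2 × ℤ) × (Cell 2 × ℤ), if 0 < ‖bondVec a b w x‖ ∧ ‖bondVec a b w x‖ ≤ ϱ then pairDebit θR θN a b w φ x else 0

/-- THE CLUSTER SHARE OF THE DEBIT at centre `c`: each in-range pair's debit times (pair weight / pair mass), D⁗'s partition (ZZZYRB `pairWeight`,
`pairMass`, radius `R`). [g99] -/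
noncomputable def clusterDebit (ϱ R : ℝ) (θR θN : (Cell 2 × ℤ) × (Cell 2 × ℤ) → ℝ) (a b : E3) (w : ℤ → E3) (c : Cell 2 × ℤ) (φ : Cell 2 → ℤ → E3) : ℝ :=
  ∑ᶠ x : (Cell 2 × ℤ) × (Cell 2 × ℤ),
    pairWeight R a b w c x / pairMass R a b w x * (if 0 < ‖bondVec a b w x‖ ∧ ‖bondVec a b w x‖ ≤ ϱ then pairDebit θR θN a b w φ x else 0)

/-! ### The three pieces -/

/-- **(TL♯-D) «TailDebitP s Λ c₀ ℓ₀ ϱ ΘR ΘN γT»** — THE FAR TAIL AS AN IN-RANGE DEBIT (support · ATTACKABLE-M): on every admissible word `(L, w')`,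
for every finitely supported `φ` and every value `E` of the ordered-pair harmonic form,
`rangeHessSum ϱ − debitForm ϱ (ΘR L w') (ΘN L w') − 2γT·nnFormZ ≤ E`.  Proof route (file docstring; memo NODE-g99 §2, §6): (TL-1) termwise
`⟨v, forceConst e v⟩ ≥ −a₋(‖e‖)·⟨e, v⟩²/‖e‖²` for `‖e‖ > ϱ ≥ 11/9` (B `forceConst_apply`); (TL-2) summability and `E = rangeHessSum ϱ + Σ_far`
(UY `norm_layeredKernel_le`); (TL-IS) the index-split Cauchy–Schwarz inequality above (pure algebra, any `α > 0`, any split through sites with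
pieces `≤ ϱ`); Fubini over (far pair, piece); the word's tables are the resulting piece sums, and the statement holds for every pair of tables
dominating them pointwise (both debit currencies are squares).  WEAKER than (U♯): a termwise inequality plus bookkeeping, no sign information on
the in-range form.  Why it might fail: only a mis-set table (a piece longer than `ϱ` over some box, or a cone ceiling below the actual piece
angle); the K-side tables carry the floors/ceilings they were built from. [g99] -/
def TailDebitP (s Λ c₀ ℓ₀ ϱ : ℝ) (ΘR ΘN : (E3 ≃L[ℝ] E3) → (ℤ → E3) → (Cell 2 × ℤ) × (Cell 2 × ℤ) → ℝ) (γT : ℝ) : Prop :=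
  ∀ a : ℝ, 0 < a → ∀ (L : E3 ≃L[ℝ] E3) (w' : ℤ → E3), IsAdmissibleWord a s Λ c₀ ℓ₀ L w' →
    ∀ φ : Cell 2 → ℤ → E3, HasFiniteSupport φ → ∀ E : ℝ,
      HasSum (fun x : (Cell 2 × ℤ) × (Cell 2 × ℤ) =>
        ⟪φ x.2.1 x.2.2 - φ x.1.1 x.1.2,
          layeredKernel (gen₁ L) (gen₂ L) w' (x.2.1 - x.1.1) x.1.2 x.2.2 (φ x.2.1 x.2.2 - φ x.1.1 x.1.2)⟫) E →
      rangeHessSum ϱ (gen₁ L) (gen₂ L) w' φ - debitForm ϱ (ΘR L w') (ΘN L w') (gen₁ L) (gen₂ L) w' φ - 2 * γT * nnFormZ φ ≤ E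

/-- **(PF♯-D) «PartitionIdentityDebitP s Λ c₀ ℓ₀ ϱ R»** — THE CLUSTER DEBITS RESUM TO THE DEBIT FORM (support · ATTACKABLE-S · bookkeeping): on
every admissible word, for every finitely supported `φ` and ALL pair tables, `Σ_c clusterDebit c φ = debitForm φ` as a `HasSum` over centres —
`Σ_c pairWeight c x = pairMass x > 0` for every pair of length `≤ ϱ` (needs `R ≥ ϱ/2 + 1`) and finsum Fubini on finite supports; the pair half
of (PF♯) with `pairHess` replaced by `pairDebit` (one proof serves both).  Why it might fail: `R` too small, as (PF♯). [g99] -/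
def PartitionIdentityDebitP (s Λ c₀ ℓ₀ ϱ R : ℝ) : Prop :=
  ∀ a : ℝ, 0 < a → ∀ (L : E3 ≃L[ℝ] E3) (w' : ℤ → E3), IsAdmissibleWord a s Λ c₀ ℓ₀ L w' →
    ∀ φ : Cell 2 → ℤ → E3, HasFiniteSupport φ → ∀ θR θN : (Cell 2 × ℤ) × (Cell 2 × ℤ) → ℝ,
      HasSum (fun c : Cell 2 × ℤ => clusterDebit ϱ R θR θN (gen₁ L) (gen₂ L) w' c φ) (debitForm ϱ θR θN (gen₁ L) (gen₂ L) w' φ)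

/-- ★ **(JF♯-D) «ClusterCertificateDebitP s Λ c₀ ℓ₀ r₁ ϱ R cK ΘR ΘN κ₁»** — THE FULL-RANGE PRESTRESSED CLUSTER CERTIFICATE NET OF THE TAIL DEBIT
(crux, rank 3 · SPECIAL · INSTRUMENTED): for every admissible word there are `μ ≥ 0`, `ν`, a short layer step and null-Lagrangian tables with the
TAIL-FREE closure `2κ₁ ≤ μ·cK − ν` and, AT EVERY CENTRE, `clusterDebit ϱ R (ΘR L w') (ΘN L w') c φ ≤ clusterFormFull r₁ ϱ R μ ν … c φ` for all
`φ` — one finite-dimensional matrix inequality per cluster: D⁗'s matrix minus the weight-shared debits `θR·ê ⊗ ê + θN·I` on its in-range pairs.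
Census format: JS53 CERT-MODE with the pair blocks of length `≤ ϱ` reduced by the debit blocks, `(μ, ν)` search, PASS iff
`min_box max_μ [μ·cK − ν_cert] ≥ 2κ₁·(1 + slack)`.  Why it might fail: the thin tensile corner — certified `0.0504` at `(ϱ, R, cK) = (49/20, 2.83,
1/10)` before debits (JS53) against an expected debit cost `0.016–0.022` at `ϱ = 4` (BLOCH99; worst-mode ratio `0.053`) plus `2κ₁ = 0.02`: thin
but positive in the Bloch reading, negative in the worst-mode reading — the pilot decides between `(4, 3)` and `(5, 7/2)` (debit `0.0075`, worst
`0.026`); beyond that the Korn-weighted stretch multiplier (edition 3b) is the reserve.  Sources: JS53 (census-1 g52–g54), BLOCH99 / TAIL99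
(lens-2 g99 desk). [g99] -/
def ClusterCertificateDebitP (s Λ c₀ ℓ₀ r₁ ϱ R cK : ℝ) (ΘR ΘN : (E3 ≃L[ℝ] E3) → (ℤ → E3) → (Cell 2 × ℤ) × (Cell 2 × ℤ) → ℝ)
    (κ₁ : ℝ) : Prop :=
  ∀ a : ℝ, 0 < a → ∀ (L : E3 ≃L[ℝ] E3) (w' : ℤ → E3), IsAdmissibleWord a s Λ c₀ ℓ₀ L w' →
    ∃ (μ ν : ℝ) (d : ℤ → Cell 2) (Cpar : ℤ → Fin 3 → Fin 3 → (E3 →L[ℝ] E3)) (Cperp : Fin 3 → Fin 3 → (E3 →L[ℝ] E3)),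
      0 ≤ μ ∧ IsShortStep r₁ (gen₁ L) (gen₂ L) w' d ∧ 2 * κ₁ ≤ μ * cK - ν ∧
      ∀ (c : Cell 2 × ℤ) (φ : Cell 2 → ℤ → E3), HasFiniteSupport φ →
        clusterDebit ϱ R (ΘR L w') (ΘN L w') (gen₁ L) (gen₂ L) w' c φ ≤ clusterFormFull r₁ ϱ R μ ν d Cpar Cperp (gen₁ L) (gen₂ L) w' c φ

/-! ### Glue -/

/-- ★★ **GLUE «TailDebit» (PROVED): (K♯) ∧ (NL♯) ∧ (TL♯-D) ∧ (PF♯) ∧ (PF♯-D) ∧ (JF♯-D) ⇒ (SP♯)** for every window list — D⁗'s degenerate budget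
`κ₁·N₁ − γT·Z ≤ E/2` word by word: `E ≥ H_ϱ − D − 2γT·Z` (tail), `0 ≤ Σ_c (clusterFormFull_c − clusterDebit_c) = H_ϱ − μS₁ + νN₁ + 0 − D`
(certificate, both partitions, (NL♯)), then `certificateFull_arith` at `τ = 0` with `H ↦ H_ϱ − D`. [g99] -/
theorem signedShellBudgetP_of_clusterCertificateDebit {s Λ c₀ ℓ₀ r₁ ϱ R cK κ₁ γT : ℝ}
    {ΘR ΘN : (E3 ≃L[ℝ] E3) → (ℤ → E3) → (Cell 2 × ℤ) × (Cell 2 × ℤ) → ℝ} {n : ℕ} {ρ C : ℕ → ℝ}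
    (hK : UniformContactKornP s Λ c₀ ℓ₀ r₁ cK) (hNL : NullLagrangianP) (hTD : TailDebitP s Λ c₀ ℓ₀ ϱ ΘR ΘN γT)
    (hPU : PartitionIdentityFullP s Λ c₀ ℓ₀ r₁ ϱ R) (hPD : PartitionIdentityDebitP s Λ c₀ ℓ₀ ϱ R)
    (hJC : ClusterCertificateDebitP s Λ c₀ ℓ₀ r₁ ϱ R cK ΘR ΘN κ₁) :
    SignedShellBudgetP s Λ c₀ ℓ₀ r₁ cK κ₁ γT n ρ C := by
  intro a ha
  refine ⟨0, κ₁, fun _ => 0, fun _ => le_rfl, ?_, ?_, ?_⟩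
  · simp
  · simp
  intro L w' hadm φ hφ E hE
  obtain ⟨μ, ν, d, Cpar, Cperp, hμ, hd, hc, hcl⟩ := hJC a ha L w' hadm
  have h1 := hTD a ha L w' hadm φ hφ E hE
  have h2 := hPU a ha L w' hadm φ hφ μ ν d Cpar Cperp hd
  have h3 := hPD a ha L w' hadm φ hφ (ΘR L w') (ΘN L w')
  have h0 : nullTotal d Cpar Cperp φ = 0 := hNL d Cpar Cperp φ hφ
  have hcert' : 0 ≤ rangeHessSum ϱ (gen₁ L) (gen₂ L) w' φ
      - μ * stretchForm 0 r₁ (gen₁ L) (gen₂ L) w' φ + ν * contactForm r₁ (gen₁ L) (gen₂ L) w' φ + nullTotal d Cpar Cperp φ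
      - debitForm ϱ (ΘR L w') (ΘN L w') (gen₁ L) (gen₂ L) w' φ :=
    HasSum.nonneg (fun c => sub_nonneg.mpr (hcl c φ hφ)) (h2.sub h3)
  have hcert : 0 ≤ (rangeHessSum ϱ (gen₁ L) (gen₂ L) w' φ - debitForm ϱ (ΘR L w') (ΘN L w') (gen₁ L) (gen₂ L) w' φ)
      - μ * stretchForm 0 r₁ (gen₁ L) (gen₂ L) w' φ + ν * contactForm r₁ (gen₁ L) (gen₂ L) w' φ := by linarith
  have h1' : (rangeHessSum ϱ (gen₁ L) (gen₂ L) w' φ - debitForm ϱ (ΘR L w') (ΘN L w') (gen₁ L) (gen₂ L) w' φ)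
      - 2 * 0 * contactForm r₁ (gen₁ L) (gen₂ L) w' φ - 2 * γT * nnFormZ φ ≤ E := by linarith
  have hc' : 2 * (κ₁ + 0) ≤ μ * cK - ν := by linarith
  obtain ⟨hK1, _⟩ := hK a ha L w' hadm φ hφ
  have hN : 0 ≤ contactForm r₁ (gen₁ L) (gen₂ L) w' φ := contactForm_nonneg _ _ _ _ _
  have hmain := certificateFull_arith h1' hcert hK1 hN hμ hc'
  simpa using hmain

/-- ★★ **THE DOOR WITH THE TAIL INSIDE THE FORM (PROVED): (RI♯) ∧ (K♯) ∧ (TL♯-D) ∧ (PF♯) ∧ (PF♯-D) ∧ (JF♯-D) ∧ (CZ♯) ⇒ (U♯)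
`UniformEquilStabilityAt s Λ κ₀ c₀`** for every `κ₀ ≤ κ₁·cZ − γT`, `0 ≤ κ₁`; (NL♯) is ZZZYRCN's theorem `nullLagrangianP`. [g99] -/
theorem uniformEquilStabilityAt_of_clusterCertificateDebit {s Λ c₀ ℓ₀ r₁ ϱ R cK cZ κ₁ κ₀ γT : ℝ}
    {ΘR ΘN : (E3 ≃L[ℝ] E3) → (ℤ → E3) → (Cell 2 × ℤ) × (Cell 2 × ℤ) → ℝ}
    (h0 : 0 ≤ κ₁) (hκ : κ₀ ≤ κ₁ * cZ - γT) (hRI : UniformReindexP s Λ c₀ ℓ₀) (hK : UniformContactKornP s Λ c₀ ℓ₀ r₁ cK)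
    (hTD : TailDebitP s Λ c₀ ℓ₀ ϱ ΘR ΘN γT) (hPU : PartitionIdentityFullP s Λ c₀ ℓ₀ r₁ ϱ R) (hPD : PartitionIdentityDebitP s Λ c₀ ℓ₀ ϱ R)
    (hJC : ClusterCertificateDebitP s Λ c₀ ℓ₀ r₁ ϱ R cK ΘR ΘN κ₁) (hCZ : IndexCurrencyP s Λ c₀ ℓ₀ r₁ cZ) :
    UniformEquilStabilityAt s Λ κ₀ c₀ :=
  uniformEquilStabilityAt_of_rigiditySplit (n := 0) (ρ := fun _ => 0) (C := fun _ => 0) h0 hκ hRI hK (shellStretchDominationP_zero _ _ _ _ _ _ _)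
    (signedShellBudgetP_of_clusterCertificateDebit hK nullLagrangianP hTD hPU hPD hJC) hCZ

end Summit.AtomisticToContinuum.Crystallization.Theorems.ChartedZeroExcessLayeredLatticeLiouville
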